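import Literature.MathematicalPhysics.QuantumFieldTheory.Balaban1983to89.T3SectALandauChart
import Literature.MathematicalPhysics.QuantumFieldTheory.Balaban1983to89.BlockAveragingExpMeanLog
import HarnessLib

/-!
# Route `UnitScaleTilt`, crux K1 child «MinimiserStabilityRegPr» (stmt-QuantumFields-19200), skeleton v10, stub `stub_existenceMinimalOrbit` (EX), route (α) — THE (B20) BINDER
# OF THE EX KNITS AT THE ROUTE's LETTER: [B11] (20) «|B| < 2dLC₁ε₁» for `B(c) = (1/i)·log(V(c)·Ū₀(c)^*)`, `Ū₀` the SYMMETRIC (0.4) k-fold average (`descendTo`, RULING g25-№3)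

Cell `ym3-torus`, width seat `ym-ust-19200-w4` (gen 2; OWNER 2026-08-28 03:32:24Z: «YOUR NEXT ROW: (B20) = the `bound20` binder of `stubEX_of_displayedRows`∕`_chartPieces` …
LOCATE which CONCRETE `Bf` … then type `bound20_of_regPr` from `RegPr`'s CloseAvg window + `norm_mlog_le_two_mul`»).  THEOREMS ONLY (0 `def`, 0 `sorry`).  YM₃ on T³ is a
ladder rung (R3), not the Clay problem; nothing here claims the stub, the crux, d = 4 or the mass gap.

LOCATED (posted 03:40Z).  In both EX knits (`Prop7StubEXOfDisplayedRows.stubEX_of_displayedRows` p599501, `Prop7StubEXOfChartPieces.stubEX_of_chartPieces`) the letter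
`Bf : ∀ L i, GaugeField(P n) → GaugeField(P K) → β L i → M₂(ℂ)` and its index type `β` are FREE binders, read only by `bound20`, by the (111)∕size rows of `h5EL`∕`hChart`
(through `H₁f(Bf)`) and by `Prop7SectET3ObjectsPd.prop6_T3_H₁B`'s abstract `hB`.  Formally any letter with the bound closes (B20); it is pinned only by the future
provability of the CHART-5 fibre clause (`e^{iB}Ū₀ = V`), i.e. [Balaban1985Variational] (20) ∕ [Balaban1985RegularSpaces] (1.31), interior case `B_b = (1/i) log(V_b(Ū₀)_b⁻¹)`
(pure small field: every bond of T³ is interior), at the ROUTE's symmetric average: with `Ū₀ := descendTo F ℰp n K h U₀` (exactly `T3SectALandauChart.CloseAvg`'s letter),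
  `Bsym(c) := (−i)·mlog(V(c)·Ū₀(c)^*)`,  `c` a bond of the comparison lattice (`β := PBond (F.P n) 0`),
stated INLINE below (no definition).  The window: `MatrixLog.norm_mlog_le_two_mul` needs `‖VŪ₀^* − 1‖ ≤ ½`; `CloseAvg (L³ε₁)` gives `‖VŪ₀^* − 1‖ = ‖Ū₀ − V‖ < L³ε₁`, so the
bound `‖Bsym(c)‖ < 2L³ε₁ ≤ 2·3L·L³ε₁` holds under `L³ε₁ ≤ ½` — a smallness window the displayed `bound20` binder does NOT carry (it quantifies all `ε₁ > 0`; located ✗ and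
reported: the knit threads its `ε₁ ≤ a₁′` or adds the window).  The 𝔰𝔲(2) facts of (20) («B Hermitian traceless», for the chart `e^{iB}`) hold on the window `L³ε₁ ≤ ⅓`
(`ExpMeanLog.star_mlog_eq_neg`, `trace_mlog_eq_zero`), and the dictionary `e^{iBsym(c)}·Ū₀(c) = V(c)` is `MatrixLog.exp_mlog`.

WHAT IS PROVED (ns `…Theorems.Prop7Bound20SymLog`).  §1 `norm_mul_star_descendTo_sub_one` (`‖VŪ₀^* − 1‖ = ‖Ū₀ − V‖`), `norm_symLog_lt` (pointwise `< 2b` on `b ≤ ½`),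
★ `bound20_symLog_of_closeAvg` (the `bound20` text at the letter `Bsym`, sup norm, window `L³ε₁ ≤ ½`); §2 `exp_I_smul_symLog_mul_descendTo` (`e^{iB}Ū₀ = V`),
`symLog_isHermitian`, `symLog_trace` (𝔰𝔲(2)-valuedness on `b ≤ ⅓`).

HONEST SCOPE.  Elementary (series logarithm on the unitary group); nothing of [Balaban1985Variational] is asserted beyond the quoted inequality's shape; `--supports
stmt-QuantumFields-19200`, count-neutral.

References: T. Bałaban, CMP 102 (1985) 277–309 [Balaban1985Variational] ((20) p.281, (14) p.280); CMP 99 (1985) 75–102 [Balaban1985RegularSpaces] ((1.31) p.82, (1.37) p.82);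
CMP 98 (1985) 17–51 [Balaban1985Averaging] ((21)–(23), (26) pp.21–22).
-/

set_option autoImplicit false

noncomputable section

open scoped BigOperators Matrix.Norms.L2Operator Matrix

namespace Summit.QuantumFields.YangMills.Theorems.Prop7Bound20SymLog

open NormedSpace
open Literature.MathematicalPhysics.QuantumFieldTheory.Balaban1983to89
open Literature.MathematicalPhysics.QuantumFieldTheory.Balaban1983to89.T3ContinuumYM3Torus
open Literature.MathematicalPhysics.QuantumFieldTheory.Balaban1983to89.T3UnitLawDensityEML (ℰp)
open Literature.MathematicalPhysics.QuantumFieldTheory.Balaban1983to89.T3TiltDescent (descendTo)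
open Literature.MathematicalPhysics.QuantumFieldTheory.Balaban1983to89.T3SectALandauChart (CloseAvg)
open Literature.MathematicalPhysics.QuantumFieldTheory.Balaban1983to89.MatrixLog (mlog exp_mlog norm_mlog_le_two_mul)
open Literature.MathematicalPhysics.QuantumFieldTheory.Balaban1983to89.ExpMeanLog (star_mlog_eq_neg trace_mlog_eq_zero)

variable (F : T3Family) {n K : ℕ} (h : n ≤ K)

/-! ## §1 The size of `Bsym = (1/i)·log(VŪ₀^*)` from (14)'s closeness `|Ū₀ − V| < b` -/

/-- `‖V(c)Ū₀(c)^* − 1‖ = ‖Ū₀(c) − V(c)‖` (`Ū₀(c)` unitary). [folklore] -/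
theorem norm_mul_star_descendTo_sub_one (V : GaugeField (F.P n) 0 (Matrix.specialUnitaryGroup (Fin 2) ℂ))
    (U₀ : GaugeField (F.P K) 0 (Matrix.specialUnitaryGroup (Fin 2) ℂ)) (c : PBond (F.P n) 0) :
    ‖((V c : Matrix.specialUnitaryGroup (Fin 2) ℂ) : Matrix (Fin 2) (Fin 2) ℂ)
          * star ((descendTo F ℰp n K h U₀ c : Matrix.specialUnitaryGroup (Fin 2) ℂ) : Matrix (Fin 2) (Fin 2) ℂ) - 1‖
      = ‖((descendTo F ℰp n K h U₀ c : Matrix.specialUnitaryGroup (Fin 2) ℂ) : Matrix (Fin 2) (Fin 2) ℂ)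
          - ((V c : Matrix.specialUnitaryGroup (Fin 2) ℂ) : Matrix (Fin 2) (Fin 2) ℂ)‖ := by
  set W : Matrix (Fin 2) (Fin 2) ℂ := ((descendTo F ℰp n K h U₀ c : Matrix.specialUnitaryGroup (Fin 2) ℂ) : Matrix (Fin 2) (Fin 2) ℂ) with hW
  have hWu : W ∈ Matrix.unitaryGroup (Fin 2) ℂ := (descendTo F ℰp n K h U₀ c).2.1
  have hWW : W * star W = 1 := Matrix.mem_unitaryGroup_iff.mp hWu
  have e : ((V c : Matrix.specialUnitaryGroup (Fin 2) ℂ) : Matrix (Fin 2) (Fin 2) ℂ) * star W - 1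
      = (((V c : Matrix.specialUnitaryGroup (Fin 2) ℂ) : Matrix (Fin 2) (Fin 2) ℂ) - W) * star W := by
    rw [sub_mul, hWW]
  rw [e, CStarRing.norm_mul_mem_unitary _ (Unitary.star_mem hWu), norm_sub_rev]

/-- **POINTWISE (20)**: if `|Ū₀(c) − V(c)| < b ≤ ½` at the bond `c` then `‖(−i)·mlog(V(c)Ū₀(c)^*)‖ < 2b` ([Balaban1985Averaging] (26): `|log X| ≤ 2|X − 1|`).
[cite: Balaban1985Variational, (20) p.281; Balaban1985RegularSpaces, (1.37) p.82] -/
theorem norm_symLog_lt {b : ℝ} (hb : b ≤ 1 / 2) (V : GaugeField (F.P n) 0 (Matrix.specialUnitaryGroup (Fin 2) ℂ))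
    (U₀ : GaugeField (F.P K) 0 (Matrix.specialUnitaryGroup (Fin 2) ℂ)) (hclose : CloseAvg F n K h b V U₀) (c : PBond (F.P n) 0) :
    ‖(-Complex.I) • mlog (((V c : Matrix.specialUnitaryGroup (Fin 2) ℂ) : Matrix (Fin 2) (Fin 2) ℂ)
          * star ((descendTo F ℰp n K h U₀ c : Matrix.specialUnitaryGroup (Fin 2) ℂ) : Matrix (Fin 2) (Fin 2) ℂ))‖ < 2 * b := by
  have hc := hclose c
  have hn := norm_mul_star_descendTo_sub_one F h V U₀ c
  have hX : ‖((V c : Matrix.specialUnitaryGroup (Fin 2) ℂ) : Matrix (Fin 2) (Fin 2) ℂ)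
          * star ((descendTo F ℰp n K h U₀ c : Matrix.specialUnitaryGroup (Fin 2) ℂ) : Matrix (Fin 2) (Fin 2) ℂ) - 1‖ ≤ 1 / 2 := by
    rw [hn]; exact hc.le.trans hb
  rw [norm_smul, norm_neg, Complex.norm_I, one_mul]
  calc _ ≤ _ := norm_mlog_le_two_mul hX
    _ < 2 * b := by rw [hn]; linarith

/-- ★ **(B20) AT THE ROUTE's LETTER** — the `bound20` binder of the EX knits for `Bf L i V U₀ := fun c ↦ (−i)·mlog(V(c)·Ū₀(c)^*)` on `β L i := PBond (P n) 0` (sup norm),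
from (14)'s closeness `CloseAvg (L³ε₁)` and the window `L³ε₁ ≤ ½`: `‖Bsym‖ < 2L³ε₁ ≤ 2·(3L)·(L³ε₁)` (print: «hence |B| < 2dLC₁ε₁», `d = 3`, `C₁ = L³`).  The hypotheses
`PlaqSmall ε₁ V` and `RegPr (L³·3L·ε₁) U₀` of the displayed binder are not needed. [cite: Balaban1985Variational, (20) p.281, (14) p.280; Balaban1985RegularSpaces, (1.37) p.82] -/
theorem bound20_symLog_of_closeAvg {ε₁ : ℝ} (hε₁ : 0 < ε₁) (hwin : (F.L : ℝ) ^ 3 * ε₁ ≤ 1 / 2)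
    (V : GaugeField (F.P n) 0 (Matrix.specialUnitaryGroup (Fin 2) ℂ)) (U₀ : GaugeField (F.P K) 0 (Matrix.specialUnitaryGroup (Fin 2) ℂ))
    (hclose : CloseAvg F n K h ((F.L : ℝ) ^ 3 * ε₁) V U₀) :
    ‖(fun c : PBond (F.P n) 0 => (-Complex.I) • mlog (((V c : Matrix.specialUnitaryGroup (Fin 2) ℂ) : Matrix (Fin 2) (Fin 2) ℂ)
          * star ((descendTo F ℰp n K h U₀ c : Matrix.specialUnitaryGroup (Fin 2) ℂ) : Matrix (Fin 2) (Fin 2) ℂ)))‖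
      < 2 * ((3 : ℝ) * F.L) * ((F.L : ℝ) ^ 3 * ε₁) := by
  have hL1 : (1 : ℝ) ≤ (F.L : ℝ) := by have := F.hL.2; exact_mod_cast (by omega : 1 ≤ F.L)
  have hb0 : 0 < (F.L : ℝ) ^ 3 * ε₁ := by positivity
  have h1 : ‖(fun c : PBond (F.P n) 0 => (-Complex.I) • mlog (((V c : Matrix.specialUnitaryGroup (Fin 2) ℂ) : Matrix (Fin 2) (Fin 2) ℂ)
          * star ((descendTo F ℰp n K h U₀ c : Matrix.specialUnitaryGroup (Fin 2) ℂ) : Matrix (Fin 2) (Fin 2) ℂ)))‖ < 2 * ((F.L : ℝ) ^ 3 * ε₁) :=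
    (pi_norm_lt_iff (by positivity)).mpr fun c => norm_symLog_lt F h hwin V U₀ hclose c
  have h2 : 2 * ((F.L : ℝ) ^ 3 * ε₁) ≤ 2 * ((3 : ℝ) * F.L) * ((F.L : ℝ) ^ 3 * ε₁) := by nlinarith
  exact h1.trans_le h2

/-! ## §2 The dictionary `e^{iB}Ū₀ = V` and the 𝔰𝔲(2)-valuedness of `Bsym` -/

/-- **THE CONSTRAINT DATUM REPRODUCES `V`**: `exp(i·Bsym(c))·Ū₀(c) = V(c)` whenever `|Ū₀(c) − V(c)| < b ≤ ½` ((20): `Q_k(U₀, ηA) = B` is the statement that the chart point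
averages to `e^{iB}Ū₀ = V`). [cite: Balaban1985Variational, (20) p.281; Balaban1985RegularSpaces, (1.31) p.82] -/
theorem exp_I_smul_symLog_mul_descendTo {b : ℝ} (hb : b ≤ 1 / 2) (V : GaugeField (F.P n) 0 (Matrix.specialUnitaryGroup (Fin 2) ℂ))
    (U₀ : GaugeField (F.P K) 0 (Matrix.specialUnitaryGroup (Fin 2) ℂ)) (hclose : CloseAvg F n K h b V U₀) (c : PBond (F.P n) 0) :
    exp (Complex.I • ((-Complex.I) • mlog (((V c : Matrix.specialUnitaryGroup (Fin 2) ℂ) : Matrix (Fin 2) (Fin 2) ℂ)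
          * star ((descendTo F ℰp n K h U₀ c : Matrix.specialUnitaryGroup (Fin 2) ℂ) : Matrix (Fin 2) (Fin 2) ℂ))))
        * ((descendTo F ℰp n K h U₀ c : Matrix.specialUnitaryGroup (Fin 2) ℂ) : Matrix (Fin 2) (Fin 2) ℂ)
      = ((V c : Matrix.specialUnitaryGroup (Fin 2) ℂ) : Matrix (Fin 2) (Fin 2) ℂ) := by
  set W : Matrix (Fin 2) (Fin 2) ℂ := ((descendTo F ℰp n K h U₀ c : Matrix.specialUnitaryGroup (Fin 2) ℂ) : Matrix (Fin 2) (Fin 2) ℂ) with hW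
  have hWu : W ∈ Matrix.unitaryGroup (Fin 2) ℂ := (descendTo F ℰp n K h U₀ c).2.1
  have hWW : star W * W = 1 := Matrix.mem_unitaryGroup_iff'.mp hWu
  have hX : ‖((V c : Matrix.specialUnitaryGroup (Fin 2) ℂ) : Matrix (Fin 2) (Fin 2) ℂ) * star W - 1‖ < 1 := by
    rw [norm_mul_star_descendTo_sub_one F h V U₀ c]
    exact (hclose c).trans_le (hb.trans (by norm_num))
  rw [smul_smul, show Complex.I * -Complex.I = 1 by rw [mul_neg, Complex.I_mul_I, neg_neg], one_smul, exp_mlog hX,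
    mul_assoc, hWW, mul_one]

/-- **`Bsym(c)` IS HERMITIAN** on the window `b ≤ ⅓` (the log of a unitary close to `1` is `i`·Hermitian). [cite: Balaban1985Averaging, (22)-(23) p.21] -/
theorem symLog_isHermitian {b : ℝ} (hb : b ≤ 1 / 3) (V : GaugeField (F.P n) 0 (Matrix.specialUnitaryGroup (Fin 2) ℂ))
    (U₀ : GaugeField (F.P K) 0 (Matrix.specialUnitaryGroup (Fin 2) ℂ)) (hclose : CloseAvg F n K h b V U₀) (c : PBond (F.P n) 0) :
    ((-Complex.I) • mlog (((V c : Matrix.specialUnitaryGroup (Fin 2) ℂ) : Matrix (Fin 2) (Fin 2) ℂ)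
          * star ((descendTo F ℰp n K h U₀ c : Matrix.specialUnitaryGroup (Fin 2) ℂ) : Matrix (Fin 2) (Fin 2) ℂ))).IsHermitian := by
  have hU : ((V c : Matrix.specialUnitaryGroup (Fin 2) ℂ) : Matrix (Fin 2) (Fin 2) ℂ)
        * star ((descendTo F ℰp n K h U₀ c : Matrix.specialUnitaryGroup (Fin 2) ℂ) : Matrix (Fin 2) (Fin 2) ℂ) ∈ Matrix.unitaryGroup (Fin 2) ℂ :=
    ((V c) * (descendTo F ℰp n K h U₀ c)⁻¹).2.1
  have hs : ‖((V c : Matrix.specialUnitaryGroup (Fin 2) ℂ) : Matrix (Fin 2) (Fin 2) ℂ)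
        * star ((descendTo F ℰp n K h U₀ c : Matrix.specialUnitaryGroup (Fin 2) ℂ) : Matrix (Fin 2) (Fin 2) ℂ) - 1‖ ≤ 1 / 3 := by
    rw [norm_mul_star_descendTo_sub_one F h V U₀ c]; exact (hclose c).le.trans hb
  show star _ = _
  rw [star_smul, star_neg, Complex.star_def, Complex.conj_I, neg_neg, star_mlog_eq_neg hU hs, smul_neg, neg_smul]

/-- **`Bsym(c)` IS TRACELESS** on the window `b ≤ ⅓` (`det(VŪ₀^*) = 1`, `2‖VŪ₀^* − 1‖ < π`). [cite: Balaban1985Averaging, (22)-(23) p.21] -/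
theorem symLog_trace {b : ℝ} (hb : b ≤ 1 / 3) (V : GaugeField (F.P n) 0 (Matrix.specialUnitaryGroup (Fin 2) ℂ))
    (U₀ : GaugeField (F.P K) 0 (Matrix.specialUnitaryGroup (Fin 2) ℂ)) (hclose : CloseAvg F n K h b V U₀) (c : PBond (F.P n) 0) :
    Matrix.trace ((-Complex.I) • mlog (((V c : Matrix.specialUnitaryGroup (Fin 2) ℂ) : Matrix (Fin 2) (Fin 2) ℂ)
          * star ((descendTo F ℰp n K h U₀ c : Matrix.specialUnitaryGroup (Fin 2) ℂ) : Matrix (Fin 2) (Fin 2) ℂ))) = 0 := by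
  have hSU : ((V c : Matrix.specialUnitaryGroup (Fin 2) ℂ) : Matrix (Fin 2) (Fin 2) ℂ)
        * star ((descendTo F ℰp n K h U₀ c : Matrix.specialUnitaryGroup (Fin 2) ℂ) : Matrix (Fin 2) (Fin 2) ℂ) ∈ Matrix.specialUnitaryGroup (Fin 2) ℂ :=
    ((V c) * (descendTo F ℰp n K h U₀ c)⁻¹).2
  have hs : ‖((V c : Matrix.specialUnitaryGroup (Fin 2) ℂ) : Matrix (Fin 2) (Fin 2) ℂ)
        * star ((descendTo F ℰp n K h U₀ c : Matrix.specialUnitaryGroup (Fin 2) ℂ) : Matrix (Fin 2) (Fin 2) ℂ) - 1‖ ≤ 1 / 3 := by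
    rw [norm_mul_star_descendTo_sub_one F h V U₀ c]; exact (hclose c).le.trans hb
  have hπ : (Fintype.card (Fin 2) : ℝ) * ‖((V c : Matrix.specialUnitaryGroup (Fin 2) ℂ) : Matrix (Fin 2) (Fin 2) ℂ)
        * star ((descendTo F ℰp n K h U₀ c : Matrix.specialUnitaryGroup (Fin 2) ℂ) : Matrix (Fin 2) (Fin 2) ℂ) - 1‖ < Real.pi := by
    rw [Fintype.card_fin]
    have := Real.pi_gt_three
    push_cast
    nlinarith
  rw [Matrix.trace_smul, trace_mlog_eq_zero hSU hs hπ, smul_zero]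

end Summit.QuantumFields.YangMills.Theorems.Prop7Bound20SymLog

end
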